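import Literature.Computability.AlgebraicComplexity.BI17TensorGenericFiniteStabilizer
import Literature.Computability.AlgebraicComplexity.BI17GenericTensorPropertyGuards
import Literature.Computability.AlgebraicComplexity.StabilizerEigenbasisCharts
import Literature.Computability.AlgebraicComplexity.RazElusiveGeneralExistence
import HarnessLib

/-!
# Eigenbasis charts for stabilizers of tensors (BI 2017 Thm. 4.2 / A. M. Popov 1987) — counting

Linear algebra and counting behind an ELEMENTARY proof of "if `m > 3`, then almost all
`w ∈ ⊗³ℂ^m` have a trivial stabilizer" (A. M. Popov 1987, quoted in Bürgisser–Ikenmeyer 2017,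
proof of Thm. 4.2, TeX L1616–1618; the tree's fact `BI2017_popov_trivialStabilizer`), the tensor
twin of the forms programme `StabilizerEigenbasisCharts` / `FormChartDimensionCount` /
`GenericTrivialStabilizerProofs` (Matsumura–Monsky):

* `tensorChartImage`, `isZariskiGenericTensor_not_mem_tensorChartImage` — a polynomial family of
  triples of matrices with `#P` parameters applied to tensors supported on `S` misses almost all
  tensors as soon as `#P + #S < m³` (algebraic dependence of the `m³` coordinate polynomials,
  `exists_aeval_eq_zero_of_card_lt`);
* `apply_eq_zero_of_actTensor_diagonal_eq` — a tensor fixed by `diag a ⊗ diag b ⊗ diag c` is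
  supported on `S(a,b,c) = {(i,j,k) : a_i b_j c_k = 1}`;
* `exists_tensorEigenChart` — if `(g₁ ⊗ g₂ ⊗ g₃)·w = w` with each `gₛ` diagonalisable,
  `gₛ Pₛ = Pₛ diag(aₛ)`, then `w` lies in the image of the triple pivot chart of the eigenvalue blocks
  (`chartMatrix`, `exists_pivot_decomposition` of `StabilizerEigenbasisCharts`) applied to tensors
  supported on `S(a,b,c)`;
* `two_mul_card_mulEq_le` — for nowhere-zero `u, v` and any `λ`:
  `2·#{(i,j) : u_i v_j = λ} ≤ #{(i,i') : u_i = u_{i'}} + #{(j,j') : v_j = v_{j'}}`;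
* `card_nePairs_add_card_fixSupport_lt` — for `m ≥ 4` and nowhere-zero `a, b, c` not all three
  constant: `Σₛ #{(i,j) : aₛ_i ≠ aₛ_j} + #S(a,b,c) < m³` (the parameter count that makes the charts
  small; `m = 3` is sharp: `a = b = c = (1,ζ,ζ²)` gives equality).

Consumer: `BI17TensorGenericTrivialStabilizer.lean` (generic finiteness of the
`GL × SL × SL`-stabilizer, finite order, assembly). No new facts; `tensorChartImage` is a definition
with a body. Honest framing: an elementary counting route to a classical statement; typed ≠
endorsed; nothing here bears on VP versus VNP.
[cite: BurgisserIkenmeyer2017, Thm. 4.2 (proof, "if m > 3, then almost all w have a trivial stabilizer")]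

## References

* P. Bürgisser, C. Ikenmeyer, *Fundamental invariants of orbit closures*, J. Algebra 477 (2017),
  §4.1 and Thm. 4.2, TeX L1574–1618. [BurgisserIkenmeyer2017]
* A. M. Popov, *Irreducible semisimple linear Lie groups with finite stationary subgroups of general
  position*, Trudy Moskov. Mat. Obshch. 50 (1987) 209–248, Thm. 2 (as quoted by BI). [Popov1987]

## Tree

`actTensor_apply`, `actTensor_actTensor`, `actTensor_one`, `actTensor_diagonal_apply`
(`QuantumFunctionals*`); `tensorPt`, `IsZariskiGenericTensor` (`BI17FundamentalInvariantTensors`);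
`chartMatrix`, `chartVars`, `card_chartVars`, `chartMatrix_map_eval`, `exists_pivot_decomposition`,
`blkOf`, `blkOf_eq_blkOf_iff`, `mul_diagonal_eq_diagonal_mul_of_apply_eq_zero`
(`StabilizerEigenbasisCharts`); `exists_aeval_eq_zero_of_card_lt` (`RazElusiveGeneralExistence`).
-/

set_option Elab.async false

noncomputable section

namespace Literature.Computability.AlgebraicComplexity

open MvPolynomial Matrix

/-! ### Tensor charts -/

section TensorChart

variable {ι K P : Type*} [Fintype ι] [DecidableEq ι] [Field K]

/-- The image of the tensor chart `(G₁, G₂, G₃, S)`: all tensors `(G₁(p) ⊗ G₂(p) ⊗ G₃(p))·v` for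
parameter values `p : P → K` and tensors `v` supported on `S`.
[cite: BurgisserIkenmeyer2017, §4.1 ("almost all w") and Thm. 4.2 (proof)] -/
def tensorChartImage (G₁ G₂ G₃ : Matrix ι ι (MvPolynomial P K)) (S : Finset (ι × ι × ι)) :
    Set (ι → ι → ι → K) :=
  {w | ∃ (p : P → K) (y : ι × ι × ι → K),
    w = actTensor (G₁.map (MvPolynomial.eval p)) (G₂.map (MvPolynomial.eval p))
      (G₃.map (MvPolynomial.eval p)) (fun i j k => if (i, j, k) ∈ S then y (i, j, k) else 0)}

/-- Membership in `tensorChartImage`, unfolded. [cite: BurgisserIkenmeyer2017, §4.1 ("almost all w")] -/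
theorem mem_tensorChartImage_iff {G₁ G₂ G₃ : Matrix ι ι (MvPolynomial P K)}
    {S : Finset (ι × ι × ι)} {w : ι → ι → ι → K} :
    w ∈ tensorChartImage G₁ G₂ G₃ S ↔ ∃ (p : P → K) (y : ι × ι × ι → K),
      w = actTensor (G₁.map (MvPolynomial.eval p)) (G₂.map (MvPolynomial.eval p))
        (G₃.map (MvPolynomial.eval p)) (fun i j k => if (i, j, k) ∈ S then y (i, j, k) else 0) :=
  Iff.rfl

/-- A tensor supported on `S`, acted on by the chart matrices at a parameter value, lies in the
chart image. [cite: BurgisserIkenmeyer2017, §4.1 ("almost all w")] -/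
theorem actTensor_mem_tensorChartImage (G₁ G₂ G₃ : Matrix ι ι (MvPolynomial P K))
    {S : Finset (ι × ι × ι)} (p : P → K) {v : ι → ι → ι → K}
    (hv : ∀ i j k, (i, j, k) ∉ S → v i j k = 0) :
    actTensor (G₁.map (MvPolynomial.eval p)) (G₂.map (MvPolynomial.eval p))
      (G₃.map (MvPolynomial.eval p)) v ∈ tensorChartImage G₁ G₂ G₃ S := by
  refine ⟨p, fun t => v t.1 t.2.1 t.2.2, ?_⟩
  congr 1
  funext i j k
  by_cases h : (i, j, k) ∈ S
  · rw [if_pos h]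
  · rw [if_neg h, hv i j k h]

/-- **Generic tensors avoid the images of tensor charts with too few parameters**: if
`#P + #S < m³`, then almost all `w ∈ ⊗³K^ι` lie outside `tensorChartImage G₁ G₂ G₃ S` — the `m³`
universal coordinate polynomials of the chart, in `#P + #S` variables, are algebraically dependent
(`exists_aeval_eq_zero_of_card_lt`), and a nonzero relation between them vanishes on the image.
[cite: BurgisserIkenmeyer2017, §4.1 ("almost all w") and Thm. 4.2 (proof)] -/
theorem isZariskiGenericTensor_not_mem_tensorChartImage [Fintype P]
    (G₁ G₂ G₃ : Matrix ι ι (MvPolynomial P K)) (S : Finset (ι × ι × ι))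
    (hcard : Fintype.card P + S.card < Fintype.card ι ^ 3) :
    IsZariskiGenericTensor fun w : ι → ι → ι → K => w ∉ tensorChartImage G₁ G₂ G₃ S := by
  classical
  -- the universal chart over the parameters `P ⊕ ↥S`
  let ρ : MvPolynomial P K →ₐ[K] MvPolynomial (P ⊕ ↥S) K := rename Sum.inl
  let u : ι → ι → ι → MvPolynomial (P ⊕ ↥S) K := fun i j k =>
    if h : (i, j, k) ∈ S then X (Sum.inr ⟨(i, j, k), h⟩) else 0
  let Ψ : ι × ι × ι → MvPolynomial (P ⊕ ↥S) K := fun t =>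
    actTensor (G₁.map ρ) (G₂.map ρ) (G₃.map ρ) u t.1 t.2.1 t.2.2
  have hlt : Fintype.card (P ⊕ ↥S) < Fintype.card (ι × ι × ι) := by
    rw [Fintype.card_sum, Fintype.card_coe, Fintype.card_prod, Fintype.card_prod]
    calc Fintype.card P + S.card < Fintype.card ι ^ 3 := hcard
      _ = Fintype.card ι * (Fintype.card ι * Fintype.card ι) := by ring
  obtain ⟨Φ, hΦ0, hΦ⟩ := exists_aeval_eq_zero_of_card_lt hlt Ψ
  refine ⟨Φ, hΦ0, fun w hw hmem => hw ?_⟩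
  obtain ⟨p, y, rfl⟩ := hmem
  let q : P ⊕ ↥S → K := Sum.elim p fun s => y s.1
  have hentry : ∀ (G : Matrix ι ι (MvPolynomial P K)) (r c : ι),
      aeval q ((G.map ρ) r c) = (G.map (MvPolynomial.eval p)) r c := by
    intro G r c
    simp only [Matrix.map_apply, ρ, aeval_rename]
    rw [show q ∘ Sum.inl = p from rfl, aeval_eq_eval]
  have hu : ∀ i j k, aeval q (u i j k) = if (i, j, k) ∈ S then y (i, j, k) else 0 := by
    intro i j k
    by_cases h : (i, j, k) ∈ S
    · simp only [u, dif_pos h, aeval_X, if_pos h]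
      rfl
    · simp only [u, dif_neg h, map_zero, if_neg h]
  have hpt : tensorPt (actTensor (G₁.map (MvPolynomial.eval p)) (G₂.map (MvPolynomial.eval p))
      (G₃.map (MvPolynomial.eval p)) (fun i j k => if (i, j, k) ∈ S then y (i, j, k) else 0)) =
      fun t => aeval q (Ψ t) := by
    funext t
    simp only [tensorPt, Ψ, actTensor_apply, map_sum, map_mul, hentry, hu]
  have h2 : aeval (fun t => aeval q (Ψ t)) Φ = aeval q (aeval Ψ Φ) := by
    rw [← comp_aeval]; rfl
  rw [hpt, h2, hΦ, map_zero]

omit [Fintype ι] [DecidableEq ι] in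
/-- Finitely many Zariski-generic properties of tensors hold simultaneously generically (product of
the test polynomials). [cite: BurgisserIkenmeyer2017, §4.1 ("almost all w")] -/
theorem IsZariskiGenericTensor.forall_fintype {A : Type*} [Fintype A]
    {Q : A → (ι → ι → ι → K) → Prop} (h : ∀ a, IsZariskiGenericTensor (Q a)) :
    IsZariskiGenericTensor fun w : ι → ι → ι → K => ∀ a, Q a w := by
  classical
  choose F hF0 hF using h
  refine ⟨∏ a, F a, Finset.prod_ne_zero_iff.mpr fun a _ => hF0 a, fun w hne a => hF a w ?_⟩
  rw [map_prod] at hne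
  exact Finset.prod_ne_zero_iff.mp hne a (Finset.mem_univ a)

omit [Fintype ι] [DecidableEq ι] in
/-- A property of all tensors is Zariski-generic (test polynomial `1`).
[cite: BurgisserIkenmeyer2017, §4.1 ("almost all w")] -/
theorem IsZariskiGenericTensor.of_forall {Q : (ι → ι → ι → K) → Prop} (h : ∀ w, Q w) :
    IsZariskiGenericTensor Q :=
  ⟨1, one_ne_zero, fun w _ => h w⟩

omit [Fintype ι] [DecidableEq ι] in
/-- Generic tensors are nonzero (test polynomial: one coordinate; `ι` nonempty).
[cite: BurgisserIkenmeyer2017, §4.1 ("almost all w")] -/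
theorem isZariskiGenericTensor_ne_zero (i₀ : ι) :
    IsZariskiGenericTensor fun w : ι → ι → ι → K => w ≠ 0 := by
  refine ⟨X (i₀, i₀, i₀), X_ne_zero _, fun w hw h0 => hw ?_⟩
  rw [aeval_X, h0]
  rfl

end TensorChart

/-! ### Tensors fixed by a Matrix.diagonal triple -/

section DiagonalFix

variable {ι K : Type*} [Fintype ι] [DecidableEq ι] [Field K]

/-- **A tensor fixed by a Matrix.diagonal triple is supported where the eigenvalue product is `1`**:
if `(diag a ⊗ diag b ⊗ diag c)·v = v` then `v_{ijk} = 0` whenever `a_i b_j c_k ≠ 1`.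
[cite: BurgisserIkenmeyer2017, §4.1 (stabilizer) and Thm. 4.2 (proof)] -/
theorem apply_eq_zero_of_actTensor_diagonal_eq {a b c : ι → K} {v : ι → ι → ι → K}
    (h : actTensor (Matrix.diagonal a) (Matrix.diagonal b) (Matrix.diagonal c) v = v) {i j k : ι}
    (hne : a i * b j * c k ≠ 1) : v i j k = 0 := by
  have h1 := congr_fun (congr_fun (congr_fun h i) j) k
  rw [actTensor_diagonal_apply] at h1
  have h2 : (a i * b j * c k - 1) * v i j k = 0 := by rw [sub_mul, one_mul, h1, sub_self]
  rcases mul_eq_zero.mp h2 with h3 | h3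
  · exact absurd (sub_eq_zero.mp h3) hne
  · exact h3

/-- If `l` commutes with `diag a` (etc.) then `(l₁ ⊗ l₂ ⊗ l₃)·` preserves the tensors fixed by the
Matrix.diagonal triple. [cite: BurgisserIkenmeyer2017, §4.1 (stabilizer)] -/
theorem actTensor_diagonal_actTensor_eq {a b c : ι → K} {l₁ l₂ l₃ : Matrix ι ι K}
    (h₁ : l₁ * Matrix.diagonal a = Matrix.diagonal a * l₁) (h₂ : l₂ * Matrix.diagonal b = Matrix.diagonal b * l₂)
    (h₃ : l₃ * Matrix.diagonal c = Matrix.diagonal c * l₃) {v : ι → ι → ι → K}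
    (hv : actTensor (Matrix.diagonal a) (Matrix.diagonal b) (Matrix.diagonal c) v = v) :
    actTensor (Matrix.diagonal a) (Matrix.diagonal b) (Matrix.diagonal c) (actTensor l₁ l₂ l₃ v) = actTensor l₁ l₂ l₃ v := by
  rw [actTensor_actTensor, ← h₁, ← h₂, ← h₃, ← actTensor_actTensor, hv]

end DiagonalFix

/-! ### The triple eigenbasis chart of a diagonalisable stabilizer element -/

section EigenChart

variable {m : ℕ} {K : Type*} [Field K] [DecidableEq K]

/-- The support `S(a,b,c) = {(i,j,k) : a_i b_j c_k = 1}` of tensors fixed by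
`diag a ⊗ diag b ⊗ diag c`. [cite: BurgisserIkenmeyer2017, §4.1 (stabilizer)] -/
def fixSupport (a b c : Fin m → K) : Finset (Fin m × Fin m × Fin m) :=
  Finset.univ.filter fun t => a t.1 * b t.2.1 * c t.2.2 = 1

/-- Membership in `fixSupport`. [cite: BurgisserIkenmeyer2017, §4.1 (stabilizer)] -/
theorem mem_fixSupport_iff {a b c : Fin m → K} {t : Fin m × Fin m × Fin m} :
    t ∈ fixSupport a b c ↔ a t.1 * b t.2.1 * c t.2.2 = 1 := by
  simp only [fixSupport, Finset.mem_filter, Finset.mem_univ, true_and]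

/-- The three pivot chart matrices of the blocks of `(a, b, c)` with pivot rows `(ρ₁, ρ₂, ρ₃)`, over
the common parameter type `chartVars (blkOf a) ρ₁ ⊕ chartVars (blkOf b) ρ₂ ⊕ chartVars (blkOf c) ρ₃`.
[cite: BurgisserIkenmeyer2017, §4.1 ("almost all w") and Thm. 4.2 (proof)] -/
def tripleChartMatrix (a b c : Fin m → K) (ρ₁ ρ₂ ρ₃ : Fin m → Fin m) (s : Fin 3) :
    Matrix (Fin m) (Fin m) (MvPolynomial
      (chartVars (blkOf a) ρ₁ ⊕ chartVars (blkOf b) ρ₂ ⊕ chartVars (blkOf c) ρ₃) K) :=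
  ![(chartMatrix K (blkOf a) ρ₁).map (rename Sum.inl),
    (chartMatrix K (blkOf b) ρ₂).map (rename (Sum.inr ∘ Sum.inl)),
    (chartMatrix K (blkOf c) ρ₃).map (rename (Sum.inr ∘ Sum.inr))] s

omit [DecidableEq K] in
/-- Specialising a renamed chart matrix at `p` is specialising the chart matrix at `p ∘ f`.
[folklore] -/
private theorem map_rename_map_eval {P Q : Type*} (G : Matrix (Fin m) (Fin m) (MvPolynomial P K))
    (f : P → Q) (p : Q → K) :
    (G.map (rename f)).map (MvPolynomial.eval p) = G.map (MvPolynomial.eval (p ∘ f)) := by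
  rw [Matrix.map_map]
  congr 1
  funext x
  exact eval_rename f p x

/-- **Triple eigenbasis chart.** If `(g₁ ⊗ g₂ ⊗ g₃)·w = w` and each `gₛ` is diagonalisable —
`g₁ P₁ = P₁ diag(a)`, `g₂ P₂ = P₂ diag(b)`, `g₃ P₃ = P₃ diag(c)` with `Pₛ` invertible — then `w` lies in
the image of the triple pivot chart of the eigenvalue blocks applied to the tensors supported on
`S(a,b,c)`: `v = (P₁⁻¹ ⊗ P₂⁻¹ ⊗ P₃⁻¹)·w` is fixed by the Matrix.diagonal triple; factor `Pₛ = cₛ lₛ`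
(`exists_pivot_decomposition`), `lₛ` commuting with `diag`; then `w = (c₁ ⊗ c₂ ⊗ c₃)·((l₁ ⊗ l₂ ⊗ l₃)·v)`.
[cite: BurgisserIkenmeyer2017, §4.1 ("almost all w") and Thm. 4.2 (proof)] -/
theorem exists_tensorEigenChart {w : Fin m → Fin m → Fin m → K}
    {g₁ g₂ g₃ P₁ P₂ P₃ : Matrix (Fin m) (Fin m) K} {a b c : Fin m → K}
    (hP₁ : IsUnit P₁.det) (hP₂ : IsUnit P₂.det) (hP₃ : IsUnit P₃.det)
    (h₁ : g₁ * P₁ = P₁ * Matrix.diagonal a) (h₂ : g₂ * P₂ = P₂ * Matrix.diagonal b)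
    (h₃ : g₃ * P₃ = P₃ * Matrix.diagonal c) (hstab : actTensor g₁ g₂ g₃ w = w) :
    ∃ ρ₁ ρ₂ ρ₃ : Fin m → Fin m,
      (∀ j j', blkOf a j = blkOf a j' → ρ₁ j = ρ₁ j' → j = j') ∧
      (∀ j j', blkOf b j = blkOf b j' → ρ₂ j = ρ₂ j' → j = j') ∧
      (∀ j j', blkOf c j = blkOf c j' → ρ₃ j = ρ₃ j' → j = j') ∧
      w ∈ tensorChartImage (tripleChartMatrix a b c ρ₁ ρ₂ ρ₃ 0) (tripleChartMatrix a b c ρ₁ ρ₂ ρ₃ 1)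
        (tripleChartMatrix a b c ρ₁ ρ₂ ρ₃ 2) (fixSupport a b c) := by
  classical
  have hPP₁ : P₁ * P₁⁻¹ = 1 := Matrix.mul_nonsing_inv P₁ hP₁
  have hPP₂ : P₂ * P₂⁻¹ = 1 := Matrix.mul_nonsing_inv P₂ hP₂
  have hPP₃ : P₃ * P₃⁻¹ = 1 := Matrix.mul_nonsing_inv P₃ hP₃
  have hP'P₁ : P₁⁻¹ * P₁ = 1 := Matrix.nonsing_inv_mul P₁ hP₁
  have hP'P₂ : P₂⁻¹ * P₂ = 1 := Matrix.nonsing_inv_mul P₂ hP₂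
  have hP'P₃ : P₃⁻¹ * P₃ = 1 := Matrix.nonsing_inv_mul P₃ hP₃
  -- `P⁻¹ g = diag · P⁻¹`
  have hconj : ∀ {g P : Matrix (Fin m) (Fin m) K} {d : Fin m → K}, P⁻¹ * P = 1 →
      g * P = P * Matrix.diagonal d → P⁻¹ * g = Matrix.diagonal d * P⁻¹ := by
    intro g P d hP'P h
    calc P⁻¹ * g = P⁻¹ * g * (P * P⁻¹) := by
          rw [Matrix.mul_nonsing_inv P (Matrix.isUnit_det_of_left_inverse hP'P), Matrix.mul_one]
      _ = P⁻¹ * (g * P) * P⁻¹ := by simp only [Matrix.mul_assoc]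
      _ = Matrix.diagonal d * P⁻¹ := by rw [h, ← Matrix.mul_assoc, hP'P, Matrix.one_mul]
  -- `v = P⁻¹ · w` is fixed by the Matrix.diagonal triple, and `w = P · v`
  set v := actTensor P₁⁻¹ P₂⁻¹ P₃⁻¹ w with hv
  have hvfix : actTensor (Matrix.diagonal a) (Matrix.diagonal b) (Matrix.diagonal c) v = v := by
    rw [hv, actTensor_actTensor, ← hconj hP'P₁ h₁, ← hconj hP'P₂ h₂, ← hconj hP'P₃ h₃,
      ← actTensor_actTensor, hstab]
  have hwv : w = actTensor P₁ P₂ P₃ v := by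
    rw [hv, actTensor_actTensor, hPP₁, hPP₂, hPP₃, actTensor_one]
  -- pivot decompositions
  obtain ⟨ρ₁, hρ₁, l₁, c₁, hl₁, -, hc₁, hPcl₁⟩ := exists_pivot_decomposition (blkOf a) P₁ hP₁
  obtain ⟨ρ₂, hρ₂, l₂, c₂, hl₂, -, hc₂, hPcl₂⟩ := exists_pivot_decomposition (blkOf b) P₂ hP₂
  obtain ⟨ρ₃, hρ₃, l₃, c₃, hl₃, -, hc₃, hPcl₃⟩ := exists_pivot_decomposition (blkOf c) P₃ hP₃
  have hcomm : ∀ {d : Fin m → K} {l : Matrix (Fin m) (Fin m) K},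
      (∀ i j, blkOf d i ≠ blkOf d j → l i j = 0) → l * Matrix.diagonal d = Matrix.diagonal d * l :=
    fun {d l} hl => mul_diagonal_eq_diagonal_mul_of_apply_eq_zero fun i j hij =>
      hl i j (mt (blkOf_eq_blkOf_iff d i j).mp hij)
  refine ⟨ρ₁, ρ₂, ρ₃, hρ₁, hρ₂, hρ₃, ?_⟩
  -- `v' = l · v` is fixed, hence supported on `S(a,b,c)`, and `w = c · v'`
  have hv'fix := actTensor_diagonal_actTensor_eq (hcomm hl₁) (hcomm hl₂) (hcomm hl₃) hvfix
  have hw' : w = actTensor c₁ c₂ c₃ (actTensor l₁ l₂ l₃ v) := by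
    rw [actTensor_actTensor, ← hPcl₁, ← hPcl₂, ← hPcl₃]
    exact hwv
  let p : chartVars (blkOf a) ρ₁ ⊕ chartVars (blkOf b) ρ₂ ⊕ chartVars (blkOf c) ρ₃ → K :=
    Sum.elim (fun q => c₁ q.1.1 q.1.2) (Sum.elim (fun q => c₂ q.1.1 q.1.2) fun q => c₃ q.1.1 q.1.2)
  have e₁ : (tripleChartMatrix a b c ρ₁ ρ₂ ρ₃ 0).map (MvPolynomial.eval p) = c₁ := by
    change ((chartMatrix K (blkOf a) ρ₁).map (rename Sum.inl)).map (MvPolynomial.eval p) = c₁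
    rw [map_rename_map_eval]
    exact chartMatrix_map_eval hρ₁ hc₁
  have e₂ : (tripleChartMatrix a b c ρ₁ ρ₂ ρ₃ 1).map (MvPolynomial.eval p) = c₂ := by
    change ((chartMatrix K (blkOf b) ρ₂).map (rename (Sum.inr ∘ Sum.inl))).map
      (MvPolynomial.eval p) = c₂
    rw [map_rename_map_eval]
    exact chartMatrix_map_eval hρ₂ hc₂
  have e₃ : (tripleChartMatrix a b c ρ₁ ρ₂ ρ₃ 2).map (MvPolynomial.eval p) = c₃ := by
    change ((chartMatrix K (blkOf c) ρ₃).map (rename (Sum.inr ∘ Sum.inr))).map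
      (MvPolynomial.eval p) = c₃
    rw [map_rename_map_eval]
    exact chartMatrix_map_eval hρ₃ hc₃
  have hmem := actTensor_mem_tensorChartImage (tripleChartMatrix a b c ρ₁ ρ₂ ρ₃ 0)
    (tripleChartMatrix a b c ρ₁ ρ₂ ρ₃ 1) (tripleChartMatrix a b c ρ₁ ρ₂ ρ₃ 2)
    (S := fixSupport a b c) p (v := actTensor l₁ l₂ l₃ v) fun i j k hS =>
      apply_eq_zero_of_actTensor_diagonal_eq hv'fix (mt (mem_fixSupport_iff (t := (i, j, k))).mpr hS)
  rw [e₁, e₂, e₃, ← hw'] at hmem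
  exact hmem

omit [Field K] in
/-- The parameter count of the triple chart: `Σₛ #{(i,j) : aₛ_i ≠ aₛ_j}`.
[cite: BurgisserIkenmeyer2017, §4.1 ("almost all w") and Thm. 4.2 (proof)] -/
theorem card_tripleChartVars {a b c : Fin m → K} {ρ₁ ρ₂ ρ₃ : Fin m → Fin m}
    (hρ₁ : ∀ j j', blkOf a j = blkOf a j' → ρ₁ j = ρ₁ j' → j = j')
    (hρ₂ : ∀ j j', blkOf b j = blkOf b j' → ρ₂ j = ρ₂ j' → j = j')
    (hρ₃ : ∀ j j', blkOf c j = blkOf c j' → ρ₃ j = ρ₃ j' → j = j') :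
    Fintype.card (chartVars (blkOf a) ρ₁ ⊕ chartVars (blkOf b) ρ₂ ⊕ chartVars (blkOf c) ρ₃) =
      (Finset.univ.filter fun q : Fin m × Fin m => a q.1 ≠ a q.2).card +
      (Finset.univ.filter fun q : Fin m × Fin m => b q.1 ≠ b q.2).card +
      (Finset.univ.filter fun q : Fin m × Fin m => c q.1 ≠ c q.2).card := by
  classical
  have key : ∀ {d : Fin m → K} {ρ : Fin m → Fin m},
      (∀ j j', blkOf d j = blkOf d j' → ρ j = ρ j' → j = j') →
      Fintype.card (chartVars (blkOf d) ρ) =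
        (Finset.univ.filter fun q : Fin m × Fin m => d q.1 ≠ d q.2).card := by
    intro d ρ hρ
    rw [card_chartVars hρ]
    exact congrArg Finset.card
      (Finset.filter_congr fun q _ => not_congr (blkOf_eq_blkOf_iff d q.1 q.2))
  rw [Fintype.card_sum, Fintype.card_sum, key hρ₁, key hρ₂, key hρ₃, add_assoc]

end EigenChart

/-! ### Counting: the charts are small unless all three eigenvalue tuples are constant -/

section Count

variable {m : ℕ} {K : Type*} [Field K] [DecidableEq K]

/-- **Pair count.** For nowhere-zero `u, v : Fin m → K` and any `λ`:
`2·#{(i,j) : u_i v_j = λ} ≤ #{(i,i') : u_i = u_{i'}} + #{(j,j') : v_j = v_{j'}}`. (On the solution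
set, the `v`-class of `j` is the `i`-row `{j' : u_i v_{j'} = λ}` and the `u`-class of `i` is the
`j`-column; sum `2 ≤ p/q + q/p` over the solutions.) [cite: BurgisserIkenmeyer2017, Thm. 4.2 (proof)] -/
theorem two_mul_card_mulEq_le (u v : Fin m → K) (hu : ∀ i, u i ≠ 0) (hv : ∀ j, v j ≠ 0) (lam : K) :
    2 * (Finset.univ.filter fun q : Fin m × Fin m => u q.1 * v q.2 = lam).card ≤
      (Finset.univ.filter fun q : Fin m × Fin m => u q.1 = u q.2).card +
      (Finset.univ.filter fun q : Fin m × Fin m => v q.1 = v q.2).card := by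
  classical
  -- row / column / class sizes
  let ra : Fin m → ℕ := fun i => (Finset.univ.filter fun j : Fin m => u i * v j = lam).card
  let cb : Fin m → ℕ := fun j => (Finset.univ.filter fun i : Fin m => u i * v j = lam).card
  let pu : Fin m → ℕ := fun i => (Finset.univ.filter fun i' : Fin m => u i' = u i).card
  let qv : Fin m → ℕ := fun j => (Finset.univ.filter fun j' : Fin m => v j' = v j).card
  set A := Finset.univ.filter fun q : Fin m × Fin m => u q.1 * v q.2 = lam with hA
  -- a sum over `A` is an iterated sum, by rows or by columns
  have sumA_row : ∀ f : Fin m × Fin m → ℚ, ∑ q ∈ A, f q =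
      ∑ i, ∑ j ∈ Finset.univ.filter (fun j : Fin m => u i * v j = lam), f (i, j) := by
    intro f
    rw [hA, Finset.sum_filter, ← Finset.univ_product_univ, Finset.sum_product]
    refine Finset.sum_congr rfl fun i _ => ?_
    rw [Finset.sum_filter]
  have sumA_col : ∀ f : Fin m × Fin m → ℚ, ∑ q ∈ A, f q =
      ∑ j, ∑ i ∈ Finset.univ.filter (fun i : Fin m => u i * v j = lam), f (i, j) := by
    intro f
    rw [hA, Finset.sum_filter, ← Finset.univ_product_univ, Finset.sum_product_right]
    refine Finset.sum_congr rfl fun j _ => ?_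
    rw [Finset.sum_filter]
  -- on `A`: the `v`-class of `j` is the row of `i`, the `u`-class of `i` is the column of `j`
  have hqa : ∀ q ∈ A, qv q.2 = ra q.1 := by
    intro q hq
    rw [hA, Finset.mem_filter] at hq
    refine congrArg Finset.card (Finset.filter_congr fun j' _ => ?_)
    rw [← hq.2]
    exact ⟨fun h => by rw [h], fun h => mul_left_cancel₀ (hu q.1) h⟩
  have hpb : ∀ q ∈ A, pu q.1 = cb q.2 := by
    intro q hq
    rw [hA, Finset.mem_filter] at hq
    refine congrArg Finset.card (Finset.filter_congr fun i' _ => ?_)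
    rw [← hq.2]
    exact ⟨fun h => by rw [h], fun h => mul_right_cancel₀ (hv q.2) h⟩
  have hra_pos : ∀ q ∈ A, 0 < ra q.1 := by
    intro q hq
    rw [hA, Finset.mem_filter] at hq
    exact Finset.card_pos.mpr ⟨q.2, by simp [hq.2]⟩
  have hpu_pos : ∀ i, 0 < pu i := fun i => Finset.card_pos.mpr ⟨i, by simp⟩
  -- cardinalities as sums
  have hcardA : (A.card : ℚ) = ∑ q ∈ A, (1 : ℚ) := by simp
  have hEu : ((Finset.univ.filter fun q : Fin m × Fin m => u q.1 = u q.2).card : ℚ) =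
      ∑ i, (pu i : ℚ) := by
    simp only [pu, Finset.card_filter, Fintype.sum_prod_type]
    push_cast
    refine Finset.sum_congr rfl fun i _ => Finset.sum_congr rfl fun i' _ => ?_
    exact if_congr ⟨Eq.symm, Eq.symm⟩ rfl rfl
  have hEv : ((Finset.univ.filter fun q : Fin m × Fin m => v q.1 = v q.2).card : ℚ) =
      ∑ j, (qv j : ℚ) := by
    simp only [qv, Finset.card_filter, Fintype.sum_prod_type]
    push_cast
    refine Finset.sum_congr rfl fun j _ => Finset.sum_congr rfl fun j' _ => ?_
    exact if_congr ⟨Eq.symm, Eq.symm⟩ rfl rfl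
  -- the two half-sums
  have hS1 : ∑ q ∈ A, ((pu q.1 : ℚ) / ra q.1) ≤ ∑ i, (pu i : ℚ) := by
    rw [sumA_row]
    refine Finset.sum_le_sum fun i _ => ?_
    dsimp only
    rw [Finset.sum_const, nsmul_eq_mul]
    by_cases h0 : (Finset.univ.filter fun j : Fin m => u i * v j = lam).card = 0
    · rw [h0, Nat.cast_zero, zero_mul]; exact Nat.cast_nonneg _
    · change (ra i : ℚ) * ((pu i : ℚ) / ra i) ≤ pu i
      rw [mul_div_cancel₀ _ (Nat.cast_ne_zero.mpr h0)]
  have hS2 : ∑ q ∈ A, ((ra q.1 : ℚ) / pu q.1) ≤ ∑ j, (qv j : ℚ) := by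
    rw [Finset.sum_congr rfl fun q hq => by rw [← hqa q hq, hpb q hq], sumA_col]
    refine Finset.sum_le_sum fun j _ => ?_
    dsimp only
    rw [Finset.sum_const, nsmul_eq_mul]
    by_cases h0 : (Finset.univ.filter fun i : Fin m => u i * v j = lam).card = 0
    · rw [h0, Nat.cast_zero, zero_mul]; exact Nat.cast_nonneg _
    · change (cb j : ℚ) * ((qv j : ℚ) / cb j) ≤ qv j
      rw [mul_div_cancel₀ _ (Nat.cast_ne_zero.mpr h0)]
  -- termwise AM–GM
  have hterm : ∀ q ∈ A, (2 : ℚ) ≤ (pu q.1 : ℚ) / ra q.1 + (ra q.1 : ℚ) / pu q.1 := by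
    intro q hq
    have hp : (0 : ℚ) < pu q.1 := Nat.cast_pos.mpr (hpu_pos q.1)
    have hr : (0 : ℚ) < ra q.1 := Nat.cast_pos.mpr (hra_pos q hq)
    rw [div_add_div _ _ hr.ne' hp.ne', le_div_iff₀ (mul_pos hr hp)]
    nlinarith [sq_nonneg ((pu q.1 : ℚ) - ra q.1)]
  have hmain : (2 * A.card : ℚ) ≤
      ((Finset.univ.filter fun q : Fin m × Fin m => u q.1 = u q.2).card : ℚ) +
      ((Finset.univ.filter fun q : Fin m × Fin m => v q.1 = v q.2).card : ℚ) := by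
    rw [hEu, hEv, hcardA, Finset.mul_sum]
    calc ∑ q ∈ A, 2 * (1 : ℚ) ≤ ∑ q ∈ A, ((pu q.1 : ℚ) / ra q.1 + (ra q.1 : ℚ) / pu q.1) :=
          Finset.sum_le_sum fun q hq => by rw [mul_one]; exact hterm q hq
      _ = ∑ q ∈ A, ((pu q.1 : ℚ) / ra q.1) + ∑ q ∈ A, ((ra q.1 : ℚ) / pu q.1) :=
          Finset.sum_add_distrib
      _ ≤ _ := add_le_add hS1 hS2
  exact_mod_cast hmain

omit [Field K] in
/-- A non-constant tuple has fewer than `m²` equal ordered pairs. [folklore] -/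
private theorem card_eqPairs_lt {u : Fin m → K} (h : ∃ i j, u i ≠ u j) :
    (Finset.univ.filter fun q : Fin m × Fin m => u q.1 = u q.2).card < m ^ 2 := by
  classical
  obtain ⟨i, j, hij⟩ := h
  calc (Finset.univ.filter fun q : Fin m × Fin m => u q.1 = u q.2).card
      < (Finset.univ : Finset (Fin m × Fin m)).card :=
        Finset.card_lt_card (Finset.filter_ssubset.mpr ⟨(i, j), Finset.mem_univ _, hij⟩)
    _ = m ^ 2 := by rw [Finset.card_univ, Fintype.card_prod, Fintype.card_fin, sq]

omit [Field K] in
/-- Equal plus unequal ordered pairs: `m²`. [folklore] -/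
private theorem card_eqPairs_add_card_nePairs (u : Fin m → K) :
    (Finset.univ.filter fun q : Fin m × Fin m => u q.1 = u q.2).card +
      (Finset.univ.filter fun q : Fin m × Fin m => u q.1 ≠ u q.2).card = m ^ 2 := by
  classical
  rw [Finset.card_filter_add_card_filter_not, Finset.card_univ, Fintype.card_prod,
    Fintype.card_fin, sq]

/-- `#S(a,b,c)` summed by the third index: `Σ_k #{(i,j) : a_i b_j = c_k⁻¹}`. [folklore] -/
private theorem card_fixSupport_eq_sum_thd (a b c : Fin m → K) (hc : ∀ k, c k ≠ 0) :
    (fixSupport a b c).card =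
      ∑ k, (Finset.univ.filter fun q : Fin m × Fin m => a q.1 * b q.2 = (c k)⁻¹).card := by
  simp only [fixSupport, Finset.card_filter, Fintype.sum_prod_type]
  symm
  rw [Finset.sum_comm]
  refine Finset.sum_congr rfl fun i _ => ?_
  rw [Finset.sum_comm]
  refine Finset.sum_congr rfl fun j _ => Finset.sum_congr rfl fun k _ => ?_
  exact if_congr (mul_eq_one_iff_eq_inv₀ (hc k)).symm rfl rfl

/-- `#S(a,b,c)` summed by the first index: `Σ_i #{(j,k) : b_j c_k = a_i⁻¹}`. [folklore] -/
private theorem card_fixSupport_eq_sum_fst (a b c : Fin m → K) (ha : ∀ i, a i ≠ 0) :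
    (fixSupport a b c).card =
      ∑ i, (Finset.univ.filter fun q : Fin m × Fin m => b q.1 * c q.2 = (a i)⁻¹).card := by
  simp only [fixSupport, Finset.card_filter, Fintype.sum_prod_type]
  refine Finset.sum_congr rfl fun i _ => Finset.sum_congr rfl fun j _ =>
    Finset.sum_congr rfl fun k _ => ?_
  refine if_congr ?_ rfl rfl
  rw [← mul_eq_one_iff_eq_inv₀ (ha i), show a i * b j * c k = b j * c k * a i by ring]

/-- `#S(a,b,c)` summed by the second index: `Σ_j #{(i,k) : a_i c_k = b_j⁻¹}`. [folklore] -/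
private theorem card_fixSupport_eq_sum_snd (a b c : Fin m → K) (hb : ∀ j, b j ≠ 0) :
    (fixSupport a b c).card =
      ∑ j, (Finset.univ.filter fun q : Fin m × Fin m => a q.1 * c q.2 = (b j)⁻¹).card := by
  simp only [fixSupport, Finset.card_filter, Fintype.sum_prod_type]
  symm
  rw [Finset.sum_comm]
  refine Finset.sum_congr rfl fun i _ => Finset.sum_congr rfl fun j _ =>
    Finset.sum_congr rfl fun k _ => ?_
  refine if_congr ?_ rfl rfl
  rw [← mul_eq_one_iff_eq_inv₀ (hb j), mul_right_comm]

/-- **The count.** For `m ≥ 4` and nowhere-zero `a, b, c : Fin m → K`, not all three constant: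
`#{a_i ≠ a_j} + #{b_i ≠ b_j} + #{c_i ≠ c_j} + #S(a,b,c) < m³`. (From the pair count:
`2·#S ≤ m(E_a + E_b)` and cyclically, so `3·#S ≤ m(E_a+E_b+E_c)`; with `E_a+E_b+E_c ≤ 3m² − 1` this
gives `3·total ≤ 9m² + (m−3)(3m²−1) < 3m³`.) For `m = 3` the bound fails exactly at
`a = b = c = (1, ζ₃, ζ₃²)`. [cite: BurgisserIkenmeyer2017, Thm. 4.2 (proof)] -/
theorem card_nePairs_add_card_fixSupport_lt (hm : 4 ≤ m) {a b c : Fin m → K}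
    (ha : ∀ i, a i ≠ 0) (hb : ∀ j, b j ≠ 0) (hc : ∀ k, c k ≠ 0)
    (hnc : (∃ i j, a i ≠ a j) ∨ (∃ i j, b i ≠ b j) ∨ (∃ i j, c i ≠ c j)) :
    (Finset.univ.filter fun q : Fin m × Fin m => a q.1 ≠ a q.2).card +
      (Finset.univ.filter fun q : Fin m × Fin m => b q.1 ≠ b q.2).card +
      (Finset.univ.filter fun q : Fin m × Fin m => c q.1 ≠ c q.2).card +
      (fixSupport a b c).card < m ^ 3 := by
  classical
  set Ea := (Finset.univ.filter fun q : Fin m × Fin m => a q.1 = a q.2).card with hEa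
  set Eb := (Finset.univ.filter fun q : Fin m × Fin m => b q.1 = b q.2).card with hEb
  set Ec := (Finset.univ.filter fun q : Fin m × Fin m => c q.1 = c q.2).card with hEc
  set S := (fixSupport a b c).card with hS
  have hFa := card_eqPairs_add_card_nePairs a
  have hFb := card_eqPairs_add_card_nePairs b
  have hFc := card_eqPairs_add_card_nePairs c
  rw [← hEa] at hFa; rw [← hEb] at hFb; rw [← hEc] at hFc
  -- `2 S ≤ m (E + E')` three ways
  have h3 : 2 * S ≤ m * (Ea + Eb) := by
    rw [hS, card_fixSupport_eq_sum_thd a b c hc, Finset.mul_sum]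
    calc ∑ k, 2 * (Finset.univ.filter fun q : Fin m × Fin m => a q.1 * b q.2 = (c k)⁻¹).card
        ≤ ∑ _k : Fin m, (Ea + Eb) := Finset.sum_le_sum fun k _ => two_mul_card_mulEq_le a b ha hb _
      _ = m * (Ea + Eb) := by rw [Finset.sum_const, Finset.card_univ, Fintype.card_fin, smul_eq_mul]
  have h1 : 2 * S ≤ m * (Eb + Ec) := by
    rw [hS, card_fixSupport_eq_sum_fst a b c ha, Finset.mul_sum]
    calc ∑ i, 2 * (Finset.univ.filter fun q : Fin m × Fin m => b q.1 * c q.2 = (a i)⁻¹).card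
        ≤ ∑ _i : Fin m, (Eb + Ec) := Finset.sum_le_sum fun i _ => two_mul_card_mulEq_le b c hb hc _
      _ = m * (Eb + Ec) := by rw [Finset.sum_const, Finset.card_univ, Fintype.card_fin, smul_eq_mul]
  have h2 : 2 * S ≤ m * (Ea + Ec) := by
    rw [hS, card_fixSupport_eq_sum_snd a b c hb, Finset.mul_sum]
    calc ∑ j, 2 * (Finset.univ.filter fun q : Fin m × Fin m => a q.1 * c q.2 = (b j)⁻¹).card
        ≤ ∑ _j : Fin m, (Ea + Ec) := Finset.sum_le_sum fun j _ => two_mul_card_mulEq_le a c ha hc _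
      _ = m * (Ea + Ec) := by rw [Finset.sum_const, Finset.card_univ, Fintype.card_fin, smul_eq_mul]
  -- `E_a + E_b + E_c ≤ 3m² − 1`
  have hEa_le : Ea ≤ m ^ 2 := by omega
  have hEb_le : Eb ≤ m ^ 2 := by omega
  have hEc_le : Ec ≤ m ^ 2 := by omega
  have hsum : Ea + Eb + Ec + 1 ≤ 3 * m ^ 2 := by
    rcases hnc with h | h | h
    · have := card_eqPairs_lt h; omega
    · have := card_eqPairs_lt h; omega
    · have := card_eqPairs_lt h; omega
  -- arithmetic
  have hm3 : 3 ≤ m := by omega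
  have key : 3 * S ≤ m * (Ea + Eb + Ec) := by nlinarith
  have key2 : (m - 3) * (Ea + Eb + Ec + 1) ≤ (m - 3) * (3 * m ^ 2) := Nat.mul_le_mul_left _ hsum
  have hm3' : m - 3 + 3 = m := by omega
  zify [hm3] at key key2 hsum hFa hFb hFc ⊢
  nlinarith [key, key2]

end Count

end Literature.Computability.AlgebraicComplexity

end
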